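import Literature.Computability.QuantumComplexity.PauliPathOrthogonality
import Mathlib.Analysis.SpecialFunctions.Pow.Real
import Mathlib.Analysis.SpecialFunctions.Sqrt
import HarnessLib

/-!
# Barrier catalogue `QuantumAdvantage` — weight-truncated Pauli-path sums fail in the worst case
# below the noise rate `1 − √(2/3)` (González-García–Cirac–Trivedi 2025)

Topic `Literature/Barriers/QuantumAdvantage` (D-0021; cell `qa-dq`, census row DQ-N3 «Pauli-path /
noise-induced simulability», the typed NEGATIVE beside the average-case theorems). Summit statement:
`QuantumAdvantage := ∃ L, L ∈ BQP ∧ L ∉ BPP` — untouched either way by this file.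

HONEST FRAMING: a no-go for ONE classical technique class (Hamming-weight truncation of the Pauli
path integral, the method of Aharonov et al. 2023 / Schuster et al. 2024) on ONE explicit circuit
family that is otherwise trivially simulable; it says nothing about classical simulability in general.

## Source (read on the page: `lit read arxiv:2407.16068`, tex chunks p0008, p0018, p0019)

G. González-García, J. I. Cirac, R. Trivedi, *Pauli path simulations of noisy quantum circuits beyond
average case*, Quantum 9 (2025) 1730 = arXiv:2407.16068 [GonzalezGarciaCiracTrivedi2025PauliPathBeyondAverageQuantum].

* §3 (p0008 L3–42): the noisy circuit `Φ = [◯_{i=1}^{d} T_p ∘ 𝒰_i] ∘ T_p`, "layers of noise `T_p`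
  are applied after every layer of unitaries, and also before the first layer … `T_p = 𝒩_p^{⊗n}`,
  `𝒩_p(ρ) = (1−p)ρ + pI/2`"; `⟨O⟩_err = Σ_s f(s)(1−p)^{|s|}` with
  `f(s) = 2^{−n(d+1)} tr(O s_d) tr(s_d U_d s_{d−1} U_d†) ⋯ tr(s_1 U_1 s_0 U_1†) tr(s_0 ρ_0)`,
  `|s| = |s_0| + ⋯ + |s_d|`; `F_w = Σ_{|s|=w} f(s)`; the algorithm's output
  `⟨O⟩_ℓ = Σ_{w ≤ ℓ} F_w (1−p)^w` and `Error = |⟨O⟩_ℓ − ⟨O⟩_err| = |Σ_{w>ℓ} F_w (1−p)^w|`.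
  — This is EXACTLY the tree's model of `PauliPathIntegral.lean` (noise layer on the input and
  after every gate layer; `pathCoeff 0 = f`, `pathCoeff p = (1−p)^{|s|} f` by
  `pathCoeff_eq_pow_mul_pathCoeff_zero`, `noisyValue p = ⟨O⟩_err` by `noisyValue_eq_sum_pathCoeff`)
  and `PauliPathOrthogonality.truncValue p ℓ = ⟨O⟩_ℓ`.
* **Lemma 5 (`V` gate)** (p0018 L12–27): "Consider the initial state `ρ_0 = (|0⟩⟨0|)^{⊗n}` … and the
  observable `O_k = ∏_{i=1}^{k} Z_{3i−2}`, with `k < n/3`. Then one can construct a circuit `𝒞` made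
  of a single layer of 3-qubit unitaries such that `F_{2k} = (3/2)^k`." The gate:
  "`V|000⟩=|000⟩, V|100⟩=|011⟩, V|001⟩=|001⟩, V|101⟩=|101⟩, V|010⟩=|010⟩, V|110⟩=|110⟩,
  V|011⟩=|100⟩, V|111⟩=|111⟩`" (majority voting; the transposition `|100⟩ ↔ |011⟩`),
  "`V†(Z_1)V = (Z_1+Z_2+Z_3)/2 − Z_1Z_2Z_3/2`", the circuit is "`V^{⊗n/3} = V_{123} ⊗ V_{456} ⊗ ⋯`",
  per block `F_1 = F_3 = 0`, `F_2 = 3/2`, `F_4 = −1/2`.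
* **Lemma 6 (Properties of `𝒞`)** (p0018 L56–p0019 L6), with `E^{(ℓ)}_{𝒞_k} = Σ_{w>ℓ} F_w(𝒞_k)(1−p)^w`:
  item (v) "For `2k < ℓ ≤ 9k/4`: `|E^{(ℓ)}_{𝒞_k}| ≥ ((3/2)(1−p)²)^k − 1 = 2^{Ω(ℓ)}, ∀ p < 1−√(2/3)`."
  (the printed proof treats `k, ℓ` even "without loss of generality"; the displayed inequality was
  checked numerically for all `k ≤ 40` and all integer `ℓ` in the range by this seat).
* **Lemma 7** (p0019 L8–14) averages `O = (1/g(n)) Σ_{k≤g(n)} O_{4k}`, `g(n) = Θ((log n)²)`, to get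
  `|Σ_{w>ℓ} F_w(1−p)^w| = 2^{Ω(ℓ)}/(log n)²` for every cut-off `ℓ = O(log n)`, and **Theorem 3
  (No-go result)** (p0019 L87–95): "it is necessary that the cut-off scales as `ℓ = ω(log n)` to ensure
  that, for all error rates and for any `O(log n)` depth quantum circuit, there exists a constant
  `ε = Θ(1)` such that `Error ≤ ε`" — i.e. superpolynomially many paths in the worst case; §4
  (p0004 L3): "the Pauli-path method fails in the worst case for all noise rates `p < 1 − √(2/3)`".

## What is typed

The explicit witness family (definitions with bodies: `GGCT.majorityFlip`, `GGCT.majorityGate`,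
`GGCT.layer k` = `V^{⊗k}` on the register `Fin k × Fin 3`, `GGCT.obs k` = `Z` on the first wire of
every block) and ONE named fact, `pauliPathTruncation_worstCase` = Lemma 6 (v) for Lemma 5's circuit,
stated over the tree's `noisyValue` / `truncValue` — the quantitative core from which Lemma 7 and
Theorem 3 follow by averaging over `k`. It is dischargeable by a finite symbolic computation
(`E^{(ℓ)}` is an explicit polynomial in `1−p`); not discharged here (net debt +1, D-0026 barrier
allowance: the single barrier fact). PROVED here: `GGCT.threshold_iff` — the meaning of the constant,
`(3/2)(1−p)² > 1 ↔ p < 1 − √(2/3)` for `0 ≤ p ≤ 1`, so the printed lower bound grows geometrically in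
`k` exactly below that rate.
-/

noncomputable section

open Matrix Finset

namespace Literature.Barriers.QuantumAdvantage

open Literature.Computability.QuantumComplexity
open Literature.Computability.QuantumComplexity.PauliPath

namespace GGCT

/-- The basis label `|100⟩` of a 3-qubit block. [cite: GonzalezGarciaCiracTrivedi2025PauliPathBeyondAverageQuantum, Lemma 5 (the gate V)] -/
def ket100 : Fin 3 → Bool := ![true, false, false]

/-- The basis label `|011⟩` of a 3-qubit block. [cite: GonzalezGarciaCiracTrivedi2025PauliPathBeyondAverageQuantum, Lemma 5 (the gate V)] -/
def ket011 : Fin 3 → Bool := ![false, true, true]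

/-- The **majority-voting permutation** of the basis labels of a 3-qubit block: `|100⟩ ↔ |011⟩`, all
other labels fixed ("`V|100⟩ = |011⟩`, `V|011⟩ = |100⟩`", the six other basis states fixed).
[cite: GonzalezGarciaCiracTrivedi2025PauliPathBeyondAverageQuantum, Lemma 5 (the gate V)] -/
def majorityFlip : (Fin 3 → Bool) → (Fin 3 → Bool) := Equiv.swap ket100 ket011

/-- `majorityFlip` is an involution. [cite: GonzalezGarciaCiracTrivedi2025PauliPathBeyondAverageQuantum, Lemma 5 (V is a permutation of order 2)] -/
theorem majorityFlip_majorityFlip (b : Fin 3 → Bool) : majorityFlip (majorityFlip b) = b :=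
  Equiv.swap_apply_self _ _ _

/-- The **gate `V`** of Lemma 5 as an `8 × 8` permutation matrix: `V_{ab} = [a = majorityFlip b]`,
i.e. `V|b⟩ = |majorityFlip b⟩`. [cite: GonzalezGarciaCiracTrivedi2025PauliPathBeyondAverageQuantum, Lemma 5 (the gate V)] -/
def majorityGate : Matrix (Fin 3 → Bool) (Fin 3 → Bool) ℂ :=
  Matrix.of fun a b => if a = majorityFlip b then 1 else 0

/-- Entries of `majorityGate`. [cite: GonzalezGarciaCiracTrivedi2025PauliPathBeyondAverageQuantum, Lemma 5] -/
@[simp] theorem majorityGate_apply (a b : Fin 3 → Bool) :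
    majorityGate a b = if a = majorityFlip b then 1 else 0 := rfl

/-- The **one-layer circuit `V^{⊗k} = V_{123} ⊗ V_{456} ⊗ ⋯`** on `n = 3k` qubits, the register being
indexed by (block, position) `∈ Fin k × Fin 3`: the matrix entry is the product over blocks of the
block entries of `V`. [cite: GonzalezGarciaCiracTrivedi2025PauliPathBeyondAverageQuantum, Lemma 5 (𝒞 = V^{⊗n/3})] -/
def layer (k : ℕ) : Matrix (Fin k × Fin 3 → Bool) (Fin k × Fin 3 → Bool) ℂ :=
  Matrix.of fun x y => ∏ i : Fin k, majorityGate (fun j => x (i, j)) (fun j => y (i, j))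

/-- The circuit as a depth-`1` layer sequence for `PauliPath.noisyValue`. [cite: GonzalezGarciaCiracTrivedi2025PauliPathBeyondAverageQuantum, Lemma 5 ("a single layer of 3-qubit unitaries")] -/
def layers (k : ℕ) : Fin 1 → Matrix (Fin k × Fin 3 → Bool) (Fin k × Fin 3 → Bool) ℂ :=
  fun _ => layer k

/-- The **observable `O_k = ∏_{i=1}^{k} Z_{3i−2}`**: Pauli `Z` on the first wire of every block,
identity elsewhere (as a Pauli string on `Fin k × Fin 3`). [cite: GonzalezGarciaCiracTrivedi2025PauliPathBeyondAverageQuantum, Lemma 5 (O_k)] -/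
def obs (k : ℕ) : Fin k × Fin 3 → Pauli :=
  fun w => if w.2 = 0 then Pauli.Z else Pauli.I

/-- The input `ρ_0 = (|0⟩⟨0|)^{⊗n}` (the tree's `proj` of the all-`false` label). [cite: GonzalezGarciaCiracTrivedi2025PauliPathBeyondAverageQuantum, Lemma 5 (ρ_0)] -/
def input (k : ℕ) : Matrix (Fin k × Fin 3 → Bool) (Fin k × Fin 3 → Bool) ℂ :=
  proj fun _ => false

/-- **The meaning of the threshold**: for a rate `0 ≤ p ≤ 1`, the base of the printed lower bound
exceeds one, `(3/2)(1−p)² > 1`, iff `p < 1 − √(2/3)` (`≈ 0.1835`).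
[cite: GonzalezGarciaCiracTrivedi2025PauliPathBeyondAverageQuantum, Lemma 6 (v) and §4 ("fails in the worst case for all noise rates p < 1−√(2/3)")] -/
theorem threshold_iff {p : ℝ} (hp1 : p ≤ 1) :
    1 < 3 / 2 * (1 - p) ^ 2 ↔ p < 1 - Real.sqrt (2 / 3) := by
  have hq : 0 ≤ 1 - p := sub_nonneg.2 hp1
  have hs : Real.sqrt (2 / 3) ^ 2 = 2 / 3 := Real.sq_sqrt (by norm_num)
  have hs0 : 0 ≤ Real.sqrt (2 / 3) := Real.sqrt_nonneg _
  constructor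
  · intro h
    have h23 : Real.sqrt (2 / 3) ^ 2 < (1 - p) ^ 2 := by rw [hs]; linarith
    have := lt_of_pow_lt_pow_left₀ 2 hq h23
    linarith
  · intro h
    have hlt : Real.sqrt (2 / 3) < 1 - p := by linarith
    have h23 : (2 : ℝ) / 3 < (1 - p) ^ 2 := by
      rw [← hs]; exact pow_lt_pow_left₀ hlt hs0 two_ne_zero
    linarith

end GGCT

/-- BARRIER (D-0021), ONE named fact — **González-García–Cirac–Trivedi, Lemma 6 (v) for the circuit of
Lemma 5** (the quantitative core of their Theorem 3 "No-go result"), over the tree's Pauli-path model: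
for every noise rate `0 ≤ p < 1 − √(2/3)` and all `k, ℓ` with `2k < ℓ ≤ 9k/4`, the Hamming-weight-`ℓ`
truncation `⟨O⟩_ℓ` (`truncValue`) of the noisy value `⟨O⟩_err` (`noisyValue`) of the observable
`O_k = ∏_i Z_{3i−2}` on the input `|0^{3k}⟩` after ONE layer of majority gates `V^{⊗k}` with
depolarizing noise of rate `p` before and after the layer errs by at least `((3/2)(1−p)²)^k − 1`:
"For `2k < ℓ ≤ 9k/4`: `|E^{(ℓ)}_{𝒞_k}| ≥ ((3/2)(1−p)²)^k − 1 = 2^{Ω(ℓ)}, ∀ p < 1−√(2/3)`",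
`E^{(ℓ)} = Σ_{w>ℓ} F_w (1−p)^w = ⟨O⟩_err − ⟨O⟩_ℓ`.
technique_class: classical estimation of noisy expectation values by truncating the Pauli path
  integral to paths of total Hamming weight `≤ ℓ` (Aharonov–Gao–Landau–Liu–Vazirani 2023; Schuster–
  Yin–Gao–Yao 2024; LOWESA-type weight truncations) with a logarithmic cut-off `ℓ = Θ(log n)`, i.e.
  polynomially many paths [cite: GonzalezGarciaCiracTrivedi2025PauliPathBeyondAverageQuantum, §3 (the algorithm ⟨O⟩_ℓ) and Thm 3].
blocks: any WORST-CASE (all circuits, all Pauli-sum observables) accuracy guarantee for that class at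
  depolarizing rates `p < 1 − √(2/3) ≈ 0.18` with `ℓ = O(log n)`: by Lemma 7 the averaged observable
  `O = (1/g(n))Σ_k O_{4k}`, `g(n) = Θ((log n)²)`, has error `2^{Ω(ℓ)}/(log n)²`, so `ℓ = ω(log n)`
  (superpolynomially many paths) is necessary (Thm 3) [cite: GonzalezGarciaCiracTrivedi2025PauliPathBeyondAverageQuantum, Lemma 7 and Thm 3].
because: after one majority layer `V†Z_1V = (Z_1+Z_2+Z_3 − Z_1Z_2Z_3)/2`, so per block the weight-2
  paths carry total coefficient `3/2 > 1` and the weight-4 path `−1/2`; across `k` blocks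
  `F_{2k} = (3/2)^k` while the exact value stays bounded, and the damping `(1−p)^{2k}` does not
  compensate as long as `(3/2)(1−p)² > 1` (`GGCT.threshold_iff`) [cite: GonzalezGarciaCiracTrivedi2025PauliPathBeyondAverageQuantum, Lemma 5 and Lemma 6].
evasions_known: AVERAGE-case guarantees (random circuits with gate-set orthogonality / anti-concentration:
  Aharonov et al. 2023; locally scrambling ensembles: Angrisani et al. 2024; random input states:
  Schuster et al. 2024) are untouched — the witness is a fixed, highly structured circuit; noise
  rates `p > 1 − 2^{−Q}` with `T`-sparsity `Q` are provably easy for the same method (their Thm 1); the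
  witness circuit itself is trivially simulable by other means (one layer of 3-qubit gates)
  [cite: GonzalezGarciaCiracTrivedi2025PauliPathBeyondAverageQuantum, §1 (abstract), Thm 1, §6 (first paragraph)].
scope_caveats: a statement about the TRUNCATED ESTIMATOR `⟨O⟩_ℓ` only (not about smarter groupings of
  paths, coefficient-threshold truncations, or any other simulator); the observable in Thm 3 is a
  convex combination of `Θ((log n)²)` Pauli strings, for a single Pauli string the large error occurs
  only in the window `2k < ℓ ≤ 9k/4` typed here; depth-1 witness, so nothing is implied about how the
  threshold moves with depth; the printed proof of Lemma 6 takes `k, ℓ` even w.l.o.g.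
  [cite: GonzalezGarciaCiracTrivedi2025PauliPathBeyondAverageQuantum, Lemma 6 (proof) and Lemma 7].
status: established (Quantum 9 (2025) 1730, refereed); typed as a named fact, dischargeable by a finite
  symbolic computation of the path polynomial `((3/2)x² − (1/2)x⁴)^k`.
[cite: GonzalezGarciaCiracTrivedi2025PauliPathBeyondAverageQuantum, Lemma 6 (v) (with Lemma 5 and Thm 3)] -/
def pauliPathTruncation_worstCase : Prop :=
  ∀ (p : ℝ), 0 ≤ p → p < 1 - Real.sqrt (2 / 3) →
    ∀ (k ℓ : ℕ), 2 * k < ℓ → 4 * ℓ ≤ 9 * k →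
      (3 / 2 * (1 - p) ^ 2) ^ k - 1 ≤
        ‖noisyValue (p : ℂ) (GGCT.layers k) (GGCT.input k) (pauliString (GGCT.obs k)) -
            truncValue (p : ℂ) ℓ (GGCT.layers k) (GGCT.input k) (pauliString (GGCT.obs k))‖

end Literature.Barriers.QuantumAdvantage
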